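import Literature.AlgebraicGeometry.AbelianSchemes.SerreTensorHomModule
import Literature.AlgebraicGeometry.AbelianSchemes.AbelianSchemePowCoproduct
import HarnessLib

/-!
# `Hom_𝒪(A₀ ⊗_𝒪 𝔟₀, Y) ≅ Hom_𝒪(A₀, Y) ⊗_𝒪 𝔟₀^∨`: Serre tensors in the SOURCE of a Hom-module

Topic `AlgebraicGeometry/AbelianSchemes`, namespace `Literature.AlgebraicGeometry.AbelianSchemes.AbelianSchemeOver` (constructions with bodies +
proved theorems; no named fact, no `sorry`, no `instance`, no notation; ANY base scheme `S`, any commutative `𝒪`).  Cell `hodgecm-mathlib`, F0/P6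
«MOD», organ **ST-4 (core, contravariant half)** of desk F0P6a-plan (g0) (ED3-CENSUS-P6a v1 §3∕§6 «`Hom_{𝒪_F}(A₀ ⊗ 𝔟₀, A ⊗ 𝔟) ≅ Hom_{𝒪_F}(A₀, A) ⊗
𝔟₀⁻¹𝔟`»: the factor `𝔟₀⁻¹ = 𝔟₀^∨` from the SOURCE), over ★ `SerreTensorHomModule` (p845207: `Hom_𝒪`, the target factor `⊗ 𝔟`) and ★
`AbelianSchemePowCoproduct` (`Aⁿ` as a coproduct); `--supports stmt-HodgeConjecture-24832`, count-neutral.  HC_CM is proved only modulo the 2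
remaining named inputs (hLiu418, h413) until rung 0 closes; this file discharges none of them.

## Mathematics

`A₀ ⊗_𝒪 𝔟₀ = Fix([E] ↷ A₀ⁿ)` is the direct factor `π : A₀ⁿ ⇄ A₀ ⊗ 𝔟₀ : ι` with `ι π = [E]`, `π ι = 𝟙`.  A homomorphism `f : A₀ ⊗ 𝔟₀ → Y` into
a commutative group scheme is the same as `h = π ≫ f : A₀ⁿ → Y` with `[E] ≫ h = h`, and `h` is the same as its components `g_k = incl_k ≫ h :
A₀ → Y` (★ `AbelianSchemePowCoproduct`: `h = ∏_k pr_k ≫ g_k`).  Since `incl_k ≫ [E] = ∏_j ι₀(E_{jk}) ≫ incl_j`, the condition `[E] h = h` reads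
`g_k = ∑_j E_{jk} • g_j = (Eᵀ·g)_k` in the `𝒪`-module `Hom_𝒪(A₀, Y)` (★ `homSubmodule`, `a • g = g ≫ ι_Y(a) = ι₀(a) ≫ g`); `𝒪`-equivariance of
`f` for the Serre action is equivariance of the `g_k` (★ `matrixEnd_scalar_comp_serreπ`).  Hence

  **`Hom_𝒪(A₀ ⊗_𝒪 𝔟₀, Y) ≃ₗ[𝒪] {g ∈ Hom_𝒪(A₀, Y)ⁿ : Eᵀ·g = g} ≃ₗ[𝒪] Hom_𝒪(A₀, Y) ⊗_𝒪 (Eᵀ·𝒪ⁿ)`**,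

and `Eᵀ·𝒪ⁿ ≅ (E·𝒪ⁿ)^∨ = 𝔟₀^∨` (= `𝔟₀⁻¹` for an invertible ideal): `Hom_𝒪(−, Y)` turns Serre tensors into tensors with the DUAL module (B. Conrad,
*Gross–Zagier revisited* §7: `Hom(M ⊗_A 𝔐, N) = Hom_A(M, Hom(𝔐, N))` for finite projective `M`; [RapoportSmithlingZhang2020Diagonal] §3.2).

## Contents

* §0 `transpose_idem` (`Eᵀ² = Eᵀ`).
* §1 `outCoord` (`g_k = incl_k ≫ π ≫ f` as an element of `Y(A₀)`), `hom_outCoord`, `outCoord_equivariant`, `outCoord_mem` (`g_k ∈ Hom_𝒪(A₀, Y)`),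
  **`outCoord_fixed`** (`Eᵀ·g = g`).
* §2 `inHom` (`h = ∏_k pr_k ≫ g_k`), `isMonHom_inHom`, `matrixEnd_scalar_comp_inHom`, `inCoord_mem` (`ι ≫ h ∈ Hom_𝒪(A₀ ⊗ 𝔟₀, Y)`),
  `powIncl_matrixEnd_comp_inHom`.
* §3 **`serreHomOutFixedEquiv : homSubmodule (serreAction act₀ E hE) actY ≃ₗ[O] fixedSubmodule (homSubmodule act₀ actY) Eᵀ`** (+ `_coe`),
  **`serreHomOutTensorEquiv : … ≃ₗ[O] homSubmodule act₀ actY ⊗[O] LinearMap.range (Matrix.toLin' Eᵀ)`**, `serreHomOutTensorEquiv_symm_tmul_coe`.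

## References
* [Conrad2004GrossZagier] B. Conrad, *Gross–Zagier revisited*, MSRI Publ. 49 (2004), §7 (Thm. 7.5).
* [RapoportSmithlingZhang2020Diagonal] M. Rapoport, B. Smithling, W. Zhang (2020), §3.2 (`Hom_{𝒪_F}(A₀, A)`).
* [MumfordFogartyKirwan1994] GIT (3rd ed.), Ch. 6 §1 Cor. 6.4 (p. 117) (homomorphisms of products of abelian schemes).
* Tree: ★ `SerreTensorHomModule`, ★ `AbelianSchemePowCoproduct`, ★ `SerreTensorPoints`, ★ `Algebra/Module/IdempotentMatrixFixedTensor`.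
-/

noncomputable section

universe u

open CategoryTheory CategoryTheory.Limits AlgebraicGeometry MonoidalCategory CartesianMonoidalCategory
open scoped MonObj TensorProduct

namespace Literature.AlgebraicGeometry.AbelianSchemes

namespace AbelianSchemeOver

open Literature.Algebra.Module.IdempotentMatrix RingAction

variable {S : Scheme.{u}} {A₀ Y : AbelianSchemeOver S} {O : Type*} [CommRing O] (act₀ : A₀.RingAction O) (actY : Y.RingAction O)
  [IsCommMonObj A₀.X] [IsCommMonObj Y.X] {n : ℕ} (E : Matrix (Fin n) (Fin n) O) (hE : E * E = E)

/-! ## §0 The transpose presentation `Eᵀ` of `𝔟₀^∨` -/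

omit [IsCommMonObj A₀.X] [IsCommMonObj Y.X] in
include hE in
/-- `Eᵀ` is idempotent. [cite: Conrad2004GrossZagier, §7] -/
theorem transpose_idem : E.transpose * E.transpose = E.transpose := by
  rw [← Matrix.transpose_mul, hE]

/-! ## §1 The components `g_k = incl_k ≫ π ≫ f` of a homomorphism `f : A₀ ⊗_𝒪 𝔟₀ → Y` -/

section Out

/-- The `k`-th component `g_k := incl_k ≫ π ≫ f ∈ Y(A₀)` of a point `f ∈ Y(A₀ ⊗ 𝔟₀)`. [cite: Conrad2004GrossZagier, §7 (Thm. 7.5)] -/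
def outCoord (x : actY.Pts (serreTensor act₀ E hE).X) (k : Fin n) : actY.Pts A₀.X :=
  Pts.mk actY A₀.X (A₀.powIncl n k ≫ serreπ act₀ E hE ≫ Pts.hom actY _ x)

omit [IsCommMonObj Y.X] in
/-- `hom (g_k) = incl_k ≫ π ≫ f`. [cite: Conrad2004GrossZagier, §7 (Thm. 7.5)] -/
@[simp]
theorem hom_outCoord (x : actY.Pts (serreTensor act₀ E hE).X) (k : Fin n) :
    Pts.hom actY A₀.X (outCoord act₀ actY E hE x k) = A₀.powIncl n k ≫ serreπ act₀ E hE ≫ Pts.hom actY _ x := rfl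

omit [IsCommMonObj Y.X] in
/-- The components of an EQUIVARIANT `f` are equivariant: `ι₀(a) ≫ g_k = g_k ≫ ι_Y(a)`. [cite: Conrad2004GrossZagier, §7 (Thm. 7.5)] -/
theorem outCoord_equivariant {x : actY.Pts (serreTensor act₀ E hE).X}
    (hx : ∀ a, (serreAction act₀ E hE).i a ≫ Pts.hom actY _ x = Pts.hom actY _ x ≫ actY.i a) (a : O) (k : Fin n) :
    act₀.i a ≫ (A₀.powIncl n k ≫ serreπ act₀ E hE ≫ Pts.hom actY _ x) =
      (A₀.powIncl n k ≫ serreπ act₀ E hE ≫ Pts.hom actY _ x) ≫ actY.i a := by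
  rw [i_comp_powIncl_serreπ_assoc, hx a]
  simp only [Category.assoc]

/-- **`g_k ∈ Hom_𝒪(A₀, Y)`** for `f ∈ Hom_𝒪(A₀ ⊗ 𝔟₀, Y)`. [cite: Conrad2004GrossZagier, §7 (Thm. 7.5)] [cite: RapoportSmithlingZhang2020Diagonal, §3.2] -/
theorem outCoord_mem {x : actY.Pts (serreTensor act₀ E hE).X} (hx : x ∈ homSubmodule (serreAction act₀ E hE) actY) (k : Fin n) :
    outCoord act₀ actY E hE x k ∈ homSubmodule act₀ actY := by
  haveI := hx.1
  haveI := A₀.isMonHom_powIncl n k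
  haveI := (isMonHom_serreι_serreπ act₀ E hE).2.1
  refine ⟨by rw [hom_outCoord]; infer_instance, fun a => ?_⟩
  rw [hom_outCoord]
  exact outCoord_equivariant act₀ actY E hE hx.2 a k

variable [IsCommMonObj (A₀.pow n).X]

/-- **`Eᵀ·g = g`**: `∏_j g_j ≫ ι_Y(E_{jk}) = g_k`, because `incl_k ≫ π = incl_k ≫ [E] ≫ π = ∏_j ι₀(E_{jk}) ≫ incl_j ≫ π`.
[cite: Conrad2004GrossZagier, §7 (Thm. 7.5)] -/
theorem outCoord_fixed {x : actY.Pts (serreTensor act₀ E hE).X} (hx : x ∈ homSubmodule (serreAction act₀ E hE) actY) :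
    smulVecLin (actY.Pts A₀.X) E.transpose (outCoord act₀ actY E hE x) = outCoord act₀ actY E hE x := by
  haveI := hx.1
  haveI := (isMonHom_serreι_serreπ act₀ E hE).2.1
  funext k
  apply Pts.hom_injective actY A₀.X
  rw [smulVecLin_apply, Pts.hom_sum, hom_outCoord]
  simp only [Matrix.transpose_apply, Pts.hom_smul, hom_outCoord]
  symm
  calc A₀.powIncl n k ≫ serreπ act₀ E hE ≫ Pts.hom actY _ x
      = (A₀.powIncl n k ≫ matrixEnd act₀ E) ≫ (serreπ act₀ E hE ≫ Pts.hom actY _ x) := by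
        rw [Category.assoc, matrixEnd_comp_serreπ_assoc]
    _ = ∏ j : Fin n, (act₀.i (E j k) ≫ A₀.powIncl n j) ≫ (serreπ act₀ E hE ≫ Pts.hom actY _ x) := by
        rw [powIncl_matrixEnd n act₀ E k, finset_prod_comp]
    _ = ∏ j : Fin n, (A₀.powIncl n j ≫ serreπ act₀ E hE ≫ Pts.hom actY _ x) ≫ actY.i (E j k) :=
        Finset.prod_congr rfl fun j _ => by rw [Category.assoc, outCoord_equivariant act₀ actY E hE hx.2]

end Out

/-! ## §2 Assembling `f = ι ≫ ∏_k pr_k ≫ g_k` from components -/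

section In

/-- `h := ∏_k pr_k ≫ g_k : A₀ⁿ → Y` assembled from a vector of points `g ∈ Y(A₀)ⁿ`. [cite: MumfordFogartyKirwan1994, Ch. 6 §1 Corollary 6.4 (p. 117)] -/
def inHom (g : Fin n → actY.Pts A₀.X) : (A₀.pow n).X ⟶ Y.X := ∏ k : Fin n, A₀.powProj n k ≫ Pts.hom actY A₀.X (g k)

omit [IsCommMonObj A₀.X] in
/-- `h` is a homomorphism when the `g_k` are. [cite: MumfordFogartyKirwan1994, Ch. 6 §1 Corollary 6.4 (p. 117)] -/
theorem isMonHom_inHom (g : Fin n → actY.Pts A₀.X) (hg : ∀ k, IsMonHom (Pts.hom actY A₀.X (g k))) : IsMonHom (inHom actY g) := by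
  refine isMonHom_finset_prod _ _ fun k _ => ?_
  haveI := hg k
  haveI := A₀.isMonHom_powProj n k
  infer_instance

omit [IsCommMonObj A₀.X] in
/-- `incl_j ≫ h = g_j`. [cite: MumfordFogartyKirwan1994, Ch. 6 §1 Corollary 6.4 (p. 117)] -/
theorem powIncl_inHom (g : Fin n → actY.Pts A₀.X) (hg : ∀ k, IsMonHom (Pts.hom actY A₀.X (g k))) (j : Fin n) :
    A₀.powIncl n j ≫ inHom actY g = Pts.hom actY A₀.X (g j) :=
  A₀.powIncl_comp_prod_powProj_comp n _ hg j

/-- `h` is equivariant for the scalar `[a·1]` when the `g_k` are equivariant: `[a·1] ≫ h = h ≫ ι_Y(a)`. [cite: Conrad2004GrossZagier, §7 (Thm. 7.5)] -/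
theorem matrixEnd_scalar_comp_inHom (g : Fin n → actY.Pts A₀.X)
    (hg : ∀ a k, act₀.i a ≫ Pts.hom actY A₀.X (g k) = Pts.hom actY A₀.X (g k) ≫ actY.i a) (a : O) :
    matrixEnd act₀ (Matrix.scalar (Fin n) a) ≫ inHom actY g = inHom actY g ≫ actY.i a := by
  haveI := actY.isMonHom a
  unfold inHom
  rw [comp_finset_prod, finset_prod_comp]
  refine Finset.prod_congr rfl fun k _ => ?_
  rw [matrixEnd_scalar_powProj_assoc, Category.assoc, hg a k]

/-- **`ι ≫ h ∈ Hom_𝒪(A₀ ⊗ 𝔟₀, Y)`** for `g ∈ Hom_𝒪(A₀, Y)ⁿ`. [cite: Conrad2004GrossZagier, §7 (Thm. 7.5)] -/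
theorem inCoord_mem (g : Fin n → homSubmodule act₀ actY) :
    Pts.mk actY (serreTensor act₀ E hE).X (serreι act₀ E hE ≫ inHom actY fun k => (g k : actY.Pts A₀.X)) ∈
      homSubmodule (serreAction act₀ E hE) actY := by
  haveI := isMonHom_inHom actY (fun k => (g k : actY.Pts A₀.X)) fun k => (g k).2.1
  haveI := (isMonHom_serreι_serreπ act₀ E hE).1
  refine ⟨by rw [Pts.hom_mk]; infer_instance, fun a => ?_⟩
  rw [Pts.hom_mk, serreAction_i_comp_ι_assoc, Category.assoc, matrixEnd_scalar_comp_inHom act₀ actY _ fun a k => (g k).2.2 a]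

/-- `incl_k ≫ [E] ≫ h = ∏_j ι₀(E_{jk}) ≫ g_j` for homomorphisms `g_j`. [cite: Conrad2004GrossZagier, §7 (Thm. 7.5)] -/
theorem powIncl_matrixEnd_comp_inHom [IsCommMonObj (A₀.pow n).X] (g : Fin n → actY.Pts A₀.X) (hg : ∀ k, IsMonHom (Pts.hom actY A₀.X (g k))) (k : Fin n) :
    A₀.powIncl n k ≫ matrixEnd act₀ E ≫ inHom actY g = ∏ j : Fin n, act₀.i (E j k) ≫ Pts.hom actY A₀.X (g j) := by
  haveI := isMonHom_inHom actY g hg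
  rw [← Category.assoc, powIncl_matrixEnd n act₀ E k, finset_prod_comp]
  refine Finset.prod_congr rfl fun j _ => ?_
  rw [Category.assoc, powIncl_inHom actY g hg]

end In

/-! ## §3 `Hom_𝒪(A₀ ⊗_𝒪 𝔟₀, Y) ≃ₗ[𝒪] Fix_{Eᵀ}(Hom_𝒪(A₀, Y)ⁿ) ≃ₗ[𝒪] Hom_𝒪(A₀, Y) ⊗_𝒪 (Eᵀ·𝒪ⁿ)` -/

section Equiv

variable [IsCommMonObj (A₀.pow n).X]

/-- **`Hom_𝒪(A₀ ⊗_𝒪 𝔟₀, Y) ≃ₗ[𝒪] {g ∈ Hom_𝒪(A₀, Y)ⁿ : Eᵀ·g = g}`**, `f ↦ (incl_k ≫ π ≫ f)_k`, inverse `g ↦ ι ≫ ∏_k pr_k ≫ g_k`.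
[cite: Conrad2004GrossZagier, §7 (Thm. 7.5)] [cite: RapoportSmithlingZhang2020Diagonal, §3.2] -/
def serreHomOutFixedEquiv :
    homSubmodule (serreAction act₀ E hE) actY ≃ₗ[O] fixedSubmodule (homSubmodule act₀ actY) E.transpose where
  toFun x := ⟨fun k => ⟨outCoord act₀ actY E hE x.1 k, outCoord_mem act₀ actY E hE x.2 k⟩, by
    rw [mem_fixedSubmodule_iff]
    funext j
    apply Subtype.ext
    rw [coe_smulVecLin_subtype]
    exact congrFun (outCoord_fixed act₀ actY E hE x.2) j⟩
  invFun g := ⟨Pts.mk actY (serreTensor act₀ E hE).X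
      (serreι act₀ E hE ≫ inHom actY fun k => ((g : Fin n → homSubmodule act₀ actY) k : actY.Pts A₀.X)),
    inCoord_mem act₀ actY E hE (g : Fin n → homSubmodule act₀ actY)⟩
  map_add' x y := by
    apply Subtype.ext; funext k; apply Subtype.ext
    apply Pts.hom_injective actY A₀.X
    change Pts.hom actY A₀.X (outCoord act₀ actY E hE (x.1 + y.1) k) =
      Pts.hom actY A₀.X (outCoord act₀ actY E hE x.1 k + outCoord act₀ actY E hE y.1 k)
    rw [hom_outCoord, Pts.hom_add, Pts.hom_add, hom_outCoord, hom_outCoord, MonObj.comp_mul, MonObj.comp_mul]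
  map_smul' c x := by
    apply Subtype.ext; funext k; apply Subtype.ext
    apply Pts.hom_injective actY A₀.X
    change Pts.hom actY A₀.X (outCoord act₀ actY E hE (c • x.1) k) = Pts.hom actY A₀.X (c • outCoord act₀ actY E hE x.1 k)
    rw [hom_outCoord, Pts.hom_smul, Pts.hom_smul, hom_outCoord, Category.assoc, Category.assoc]
  left_inv x := by
    haveI := x.2.1
    haveI := (isMonHom_serreι_serreπ act₀ E hE).2.1
    apply Subtype.ext
    apply Pts.hom_injective actY (serreTensor act₀ E hE).X
    change serreι act₀ E hE ≫ inHom actY (fun k => outCoord act₀ actY E hE x.1 k) = Pts.hom actY _ x.1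
    have h : inHom actY (fun k => outCoord act₀ actY E hE x.1 k) = serreπ act₀ E hE ≫ Pts.hom actY _ x.1 := by
      unfold inHom
      simp only [hom_outCoord]
      exact (A₀.eq_prod_powProj_comp_powIncl_comp n (serreπ act₀ E hE ≫ Pts.hom actY _ x.1)).symm
    rw [h, ← Category.assoc, (serreπ_ι_and_ι_π act₀ E hE).2, Category.id_comp]
  right_inv g := by
    apply Subtype.ext; funext k; apply Subtype.ext
    apply Pts.hom_injective actY A₀.X
    have hg : ∀ j, IsMonHom (Pts.hom actY A₀.X ((g : Fin n → homSubmodule act₀ actY) j : actY.Pts A₀.X)) :=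
      fun j => ((g : Fin n → homSubmodule act₀ actY) j).2.1
    change A₀.powIncl n k ≫ serreπ act₀ E hE ≫ Pts.hom actY _ (Pts.mk actY (serreTensor act₀ E hE).X (serreι act₀ E hE ≫ inHom actY _)) =
      Pts.hom actY A₀.X ((g : Fin n → homSubmodule act₀ actY) k : actY.Pts A₀.X)
    rw [Pts.hom_mk, ← Category.assoc (serreπ act₀ E hE), (serreπ_ι_and_ι_π act₀ E hE).1]
    refine (powIncl_matrixEnd_comp_inHom act₀ actY E _ hg k).trans ?_
    -- fixedness of `g` under `Eᵀ`: `g_k = ∑_j E_{jk} • g_j`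
    have hfix' : ((g : Fin n → homSubmodule act₀ actY) k : actY.Pts A₀.X) =
        ∑ j : Fin n, E j k • ((g : Fin n → homSubmodule act₀ actY) j : actY.Pts A₀.X) := by
      have h := congrArg (fun v : Fin n → homSubmodule act₀ actY => ((v k : homSubmodule act₀ actY) : actY.Pts A₀.X))
        ((mem_fixedSubmodule_iff _ E.transpose _).1 g.2)
      simp only [smulVecLin_apply, Matrix.transpose_apply, Submodule.coe_sum, Submodule.coe_smul] at h
      exact h.symm
    calc ∏ j : Fin n, act₀.i (E j k) ≫ Pts.hom actY A₀.X ((g : Fin n → homSubmodule act₀ actY) j : actY.Pts A₀.X)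
        = ∏ j : Fin n, Pts.hom actY A₀.X (E j k • ((g : Fin n → homSubmodule act₀ actY) j : actY.Pts A₀.X)) :=
          Finset.prod_congr rfl fun j _ => ((g : Fin n → homSubmodule act₀ actY) j).2.2 (E j k)
      _ = Pts.hom actY A₀.X (∑ j : Fin n, E j k • ((g : Fin n → homSubmodule act₀ actY) j : actY.Pts A₀.X)) :=
          (Pts.hom_sum actY A₀.X _ _).symm
      _ = Pts.hom actY A₀.X ((g : Fin n → homSubmodule act₀ actY) k : actY.Pts A₀.X) := congrArg _ hfix'.symm

/-- Coordinates of `serreHomOutFixedEquiv f`: the `k`-th is `incl_k ≫ π ≫ f`. [cite: Conrad2004GrossZagier, §7 (Thm. 7.5)] -/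
theorem serreHomOutFixedEquiv_coe (x : homSubmodule (serreAction act₀ E hE) actY) (k : Fin n) :
    Pts.hom actY A₀.X (((serreHomOutFixedEquiv act₀ actY E hE x : Fin n → homSubmodule act₀ actY) k : actY.Pts A₀.X)) =
      A₀.powIncl n k ≫ serreπ act₀ E hE ≫ Pts.hom actY _ x.1 := rfl

/-- **`Hom_𝒪(A₀ ⊗_𝒪 𝔟₀, Y) ≃ₗ[𝒪] Hom_𝒪(A₀, Y) ⊗_𝒪 (Eᵀ·𝒪ⁿ)`** (`Eᵀ·𝒪ⁿ ≅ 𝔟₀^∨`): `Hom_𝒪(−, Y)` turns the Serre tensor into the tensor with the dual.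
[cite: Conrad2004GrossZagier, §7 (Thm. 7.5)] [cite: RapoportSmithlingZhang2020Diagonal, §3.2] -/
def serreHomOutTensorEquiv :
    homSubmodule (serreAction act₀ E hE) actY ≃ₗ[O] homSubmodule act₀ actY ⊗[O] LinearMap.range (Matrix.toLin' E.transpose) :=
  (serreHomOutFixedEquiv act₀ actY E hE).trans (tensorRangeEquivFixed (homSubmodule act₀ actY) E.transpose (transpose_idem E hE)).symm

/-- On pure tensors: the inverse sends `g ⊗ w` (`g ∈ Hom_𝒪(A₀, Y)`, `w ∈ Eᵀ·𝒪ⁿ`) to the homomorphism `A₀ ⊗ 𝔟₀ → Y` with components `(w_k • g)_k`.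
[cite: Conrad2004GrossZagier, §7 (Thm. 7.5)] -/
theorem serreHomOutTensorEquiv_symm_tmul_coe (g : homSubmodule act₀ actY) (w : LinearMap.range (Matrix.toLin' E.transpose)) (k : Fin n) :
    (((serreHomOutFixedEquiv act₀ actY E hE ((serreHomOutTensorEquiv act₀ actY E hE).symm (g ⊗ₜ w)) : Fin n → homSubmodule act₀ actY) k :
      actY.Pts A₀.X)) = (w : Fin n → O) k • (g : actY.Pts A₀.X) := by
  change (((serreHomOutFixedEquiv act₀ actY E hE ((serreHomOutFixedEquiv act₀ actY E hE).symm
    (tensorRangeEquivFixed (homSubmodule act₀ actY) E.transpose (transpose_idem E hE) (g ⊗ₜ w))) : Fin n → homSubmodule act₀ actY) k :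
      actY.Pts A₀.X)) = _
  rw [LinearEquiv.apply_symm_apply, tensorRangeEquivFixed_tmul_coe, Submodule.coe_smul]

end Equiv

end AbelianSchemeOver

end Literature.AlgebraicGeometry.AbelianSchemes

end
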